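import Literature.Computability.Cryptography.QuantumCircuit
import Literature.Computability.Complexity.PairPlumbing
import Literature.Computability.Complexity.TimeBoundsProofs
import Literature.Computability.Complexity.StackMachines
import Literature.Computability.Complexity.StackLists
import HarnessLib

/-!
# Uniformity of circuit families as membership of the description function in `FP`

Family `CryptoQuantFine` / `PQC`; infrastructure for the uniformity half of constructions that
*combine* polynomial-time uniform quantum circuit families (classical wrapping, `BQP`
subroutines, relativised reversible simulation — the named facts `isQSolvable_classicalWrap`,
`isQSolvable_of_mem_BQP_oracle`, `uniformOracleCoinSimulation`). `QCircuitFamily.IsUniform F`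
(`QuantumCircuit.lean`) asks for a polynomial-time machine writing the description
`sigmaEncode ⟨n, ancillas n, circ n⟩` on the unary input `1ⁿ`; to feed a *given* uniform family
into a string-level construction one needs its description as an ordinary `FP` string function
and back:

* `QCircuitFamily.descFn F z = sigmaEncode ⟨|z|, ancillas |z|, circ |z|⟩` (the description of
  the `|z|`-th circuit, on every string of length `|z|`);
* **`isUniform_iff_descFn_mem_FP`**: `F.IsUniform ↔ F.descFn ∈ FP` — forward by composing the
  uniformity machine with the unary normaliser `z ↦ 1^{|z|}` (`onesFn_mem_FP`,
  `PolyTimeComputable.comp_holds`), backward because `IsUniform` only constrains the inputs `1ⁿ`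
  (the backward direction is also `QCircuitFamily.isUniform_of_mem_FP` of
  `QuantumComplexity/RevTableauUniform.lean`, re-proved here to keep the import light);
* the shape of descriptions for string-level processing: `QCircuit.encode_eq_encList` (the gate
  list is the right-nested pair list `encList` of `StackLists.lean`), `encode_append`,
  `sigmaEncode_eq`.

## References

* S. Arora, B. Barak, *Computational Complexity: A Modern Approach*, CUP 2009, §6.2
  (`P`-uniform families: "a polynomial-time TM that on input `1ⁿ` outputs the description of
  `Cₙ`"), Remark 6.7.
* M. A. Nielsen, I. L. Chuang, *Quantum Computation and Quantum Information*, CUP 2010, §4.5.5.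
-/

namespace Literature.Computability.Cryptography

open _root_.Computability Complexity

variable {G : QGateSet} [Encodable G.Op]

namespace QCircuit

/-- The gate-list code of a circuit is the pair list `encList` of the gate codes. [folklore] -/
theorem encode_eq_encList {n : ℕ} (C : QCircuit G n) : C.encode = encList (C.gates.map QGate.encode) := by
  obtain ⟨gs⟩ := C
  unfold QCircuit.encode
  induction gs with
  | nil => rfl
  | cons g gs ih => simp only [List.foldr_cons, List.map_cons, encList_cons]; exact congrArg _ ih

/-- The code of a concatenation is the concatenation of the codes. [folklore] -/
theorem encode_append {n : ℕ} (C D : QCircuit G n) : (C.append D).encode = C.encode ++ D.encode := by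
  rw [encode_eq_encList, encode_eq_encList, encode_eq_encList, QCircuit.gates_append, List.map_append,
    Com.encList_eq_flatMap, Com.encList_eq_flatMap, Com.encList_eq_flatMap, List.flatMap_append]

/-- The full description: `⟨bin n, ⟨1^m, gate-list code⟩⟩`. [folklore] -/
theorem sigmaEncode_eq (n m : ℕ) (C : QCircuit G (n + m)) :
    QCircuit.sigmaEncode (G := G) ⟨n, m, C⟩ = boolPair (encodeNat n) (boolPair (unaryEncodeNat m) C.encode) := rfl

end QCircuit

namespace QCircuitFamily

/-- The description function of a family on all strings: `z ↦ sigmaEncode ⟨|z|, ancillas |z|,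
circ |z|⟩`. [cite: AroraBarak2009, §6.2 (P-uniform circuit families)] -/
def descFn (F : QCircuitFamily G) (z : List Bool) : List Bool :=
  QCircuit.sigmaEncode (G := G) ⟨z.length, F.ancillas z.length, F.circ z.length⟩

/-- `descFn` on the unary input `1ⁿ` is the description of the `n`-th circuit. [folklore] -/
theorem descFn_unaryEncodeNat (F : QCircuitFamily G) (n : ℕ) :
    F.descFn (unaryEncodeNat n) = QCircuit.sigmaEncode (G := G) ⟨n, F.ancillas n, F.circ n⟩ := by
  have hn : (unaryEncodeNat n).length = n := unary_decode_encode_nat n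
  have key : ∀ m : ℕ, m = n →
      QCircuit.sigmaEncode (G := G) ⟨m, F.ancillas m, F.circ m⟩ =
        QCircuit.sigmaEncode (G := G) ⟨n, F.ancillas n, F.circ n⟩ := by
    rintro m rfl; rfl
  exact key _ hn

/-- **A uniform family has an `FP` description function**: compose the uniformity machine
with the unary normaliser `z ↦ 1^{|z|}`. [cite: AroraBarak2009, §6.2 (P-uniform circuit families), Remark 6.7] -/
theorem descFn_mem_FP_of_isUniform {F : QCircuitFamily G} (h : F.IsUniform) : F.descFn ∈ FP := by
  have hlen : PolyTimeComputable (id : List Bool → List Bool) unaryEncodeNat (List.length : List Bool → ℕ) :=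
    PolyTimeComputable.of_encode (f := (List.length : List Bool → ℕ)) onesFn_mem_FP id (fun _ => rfl) (fun _ => rfl)
  have hc := PolyTimeComputable.comp_holds h hlen
  exact PolyTimeComputable.of_encode (f := F.descFn) hc id (fun _ => rfl) (fun _ => rfl)

/-- **An `FP` description function makes the family uniform** (`IsUniform` only constrains
the inputs `1ⁿ`). [cite: AroraBarak2009, §6.2 (P-uniform circuit families)] -/
theorem isUniform_of_descFn_mem_FP {F : QCircuitFamily G} (h : F.descFn ∈ FP) : F.IsUniform :=
  PolyTimeComputable.of_encode h unaryEncodeNat (fun _ => rfl) (fun n => descFn_unaryEncodeNat F n)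

/-- **Uniformity is `FP`-ness of the description function.** [cite: AroraBarak2009, §6.2 (P-uniform circuit families), Remark 6.7] -/
theorem isUniform_iff_descFn_mem_FP (F : QCircuitFamily G) : F.IsUniform ↔ F.descFn ∈ FP :=
  ⟨descFn_mem_FP_of_isUniform, isUniform_of_descFn_mem_FP⟩

/-- Unfolding `descFn`. [folklore] -/
theorem descFn_eq (F : QCircuitFamily G) (z : List Bool) :
    F.descFn z = boolPair (encodeNat z.length) (boolPair (unaryEncodeNat (F.ancillas z.length)) (F.circ z.length).encode) := rfl

end QCircuitFamily

end Literature.Computability.Cryptography
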